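import Mathlib
import HarnessLib
import Literature.MathematicalPhysics.StatisticalMechanics.WeightMultiplierBounds

/-!
# Growth of the multipliers `m_k` across one scale at high momenta
# (Adams–Buchholz–Kotecký–Müller, (7.33)–(7.34))

The high-momentum regime of [ABKM19] Lemma 7.3 (`WeightDominatingStep.step_high`) needs
`4 m_k(p) ≤ m_{k+1}(p)` for `|p| ≥ L^{−k}` ((7.34)), where
`m_k(p) = Σ_{1≤|α|≤M} L^{2k(|α|−1)}|q(p)^α|²` (`derivMul`).  The terms with `|α| ≥ 2` gain a factor
`L^{2(|α|−1)} ≥ L² ≥ 4` from `k` to `k+1`; the terms with `|α| = 1` (which do not grow) are paid for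
by the terms `α = 2e_i` using `Σ_i |q_i|⁴ ≥ |q|⁴/d` and `|q|² ≥ (4/π²)L^{−2k}` ((7.33)).

* `derivMul_succ_sub_four_mul_nonneg` — `4 m_k ≤ m_{k+1}` whenever `s ⊇ {e_i, 2e_i}` consists of
  indices of positive order, `L ≥ 2` and `3d ≤ (L² − 4) L^{2k} |q(κ)|²`;
* `four_mul_derivMul_le_succ` — the same under `L^{−k} ≤ |p(κ)|` and `3dπ² ≤ 4(L² − 4)` ((7.34) with
  an explicit admissible `L`; [ABKM19] asks `L ≥ 8`).

Everything is proved; no named fact.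

## References
* S. Adams, S. Buchholz, R. Kotecký, S. Müller, arXiv:1910.13564, Lemma 7.3 (7.33)–(7.34)
  [AdamsBuchholzKoteckyMuller2019].
-/

noncomputable section

namespace Literature.MathematicalPhysics.StatisticalMechanics.GradientRG

open Finset Real
open Literature.MathematicalPhysics.StatisticalMechanics.GradientFRD
  (qmode qpow qnormSq momNorm qnormSq_bounds momNorm_nonneg)

variable {d M : ℕ} [NeZero M]

/-- A multi-index of order one is a unit index. [cite: AdamsBuchholzKoteckyMuller2019, Lemma 7.3 (7.34)] -/
theorem eq_single_of_sum_eq_one {α : Fin d → ℕ} (h : ∑ i, α i = 1) :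
    ∃ i, α = Pi.single i 1 := by
  obtain ⟨i, -, hi⟩ : ∃ i ∈ Finset.univ, α i ≠ 0 := by
    by_contra hc
    push Not at hc
    have : ∑ i, α i = 0 := sum_eq_zero fun i hi => hc i hi
    omega
  refine ⟨i, funext fun j => ?_⟩
  have hle_i : α i ≤ 1 := h ▸ single_le_sum (f := α) (fun _ _ => Nat.zero_le _) (mem_univ i)
  by_cases hj : j = i
  · subst hj; rw [Pi.single_eq_same]; omega
  · rw [Pi.single_eq_of_ne hj]
    have hpair : α i + α j ≤ ∑ l, α l := by
      have := sum_le_sum_of_subset_of_nonneg (f := α) (subset_univ ({i, j} : Finset (Fin d)))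
        (fun _ _ _ => Nat.zero_le _)
      rwa [sum_pair (Ne.symm hj)] at this
    omega

/-- `|q^{2e_i}| = |q_i|²`. [cite: Buchholz2016, §2 (2.18)] -/
theorem norm_qpow_single_two (i : Fin d) (κ : Fin d → ZMod M) :
    ‖qpow (Pi.single i 2) κ‖ = ‖qmode κ i‖ ^ 2 := by
  unfold qpow
  rw [norm_prod, prod_eq_single i (fun j _ hj => by rw [Pi.single_eq_of_ne hj, pow_zero, norm_one])
    (fun h => (h (mem_univ i)).elim), Pi.single_eq_same, norm_pow]

/-- `Σ_i |q_i|⁴ ≥ |q|⁴/d` (Cauchy–Schwarz), in the form `|q|²·|q|² ≤ d Σ_i |q_i|⁴`.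
[cite: AdamsBuchholzKoteckyMuller2019, Lemma 7.3 (7.33)] -/
theorem qnormSq_sq_le (κ : Fin d → ZMod M) :
    qnormSq κ ^ 2 ≤ d * ∑ i, (‖qmode κ i‖ ^ 2) ^ 2 := by
  have h := sq_sum_le_card_mul_sum_sq (s := (Finset.univ : Finset (Fin d)))
    (f := fun i => ‖qmode κ i‖ ^ 2)
  rw [card_univ, Fintype.card_fin] at h
  exact h

/-- **(7.34), core**: for an index set `s` of positive orders containing all `e_i` and `2e_i`,
`L ≥ 2`, and a mode with `3d ≤ (L² − 4) L^{2k} |q(κ)|²`: `4 m_k(κ) ≤ m_{k+1}(κ)`.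
[cite: AdamsBuchholzKoteckyMuller2019, Lemma 7.3 (7.34)] -/
theorem derivMul_succ_sub_four_mul_nonneg {L : ℝ} (hL : 2 ≤ L) (k : ℕ) {s : Finset (Fin d → ℕ)}
    (hs : ∀ α ∈ s, 1 ≤ ∑ i, α i) (hs1 : ∀ i : Fin d, (Pi.single i 1 : Fin d → ℕ) ∈ s)
    (hs2 : ∀ i : Fin d, (Pi.single i 2 : Fin d → ℕ) ∈ s) {κ : Fin d → ZMod M}
    (hκ : 3 * (d : ℝ) ≤ (L ^ 2 - 4) * L ^ (2 * k) * qnormSq κ) :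
    4 * derivMul L k s κ ≤ derivMul L (k + 1) s κ := by
  classical
  have hL0 : 0 ≤ L := by linarith
  have hL1 : 1 ≤ L := by linarith
  have hL4 : 4 ≤ L ^ 2 := by nlinarith
  -- the difference as one sum with coefficients `c α`
  set c : (Fin d → ℕ) → ℝ := fun α =>
    (L ^ (2 * (k + 1) * (∑ i, α i - 1)) - 4 * L ^ (2 * k * (∑ i, α i - 1))) * ‖qpow α κ‖ ^ 2 with hc
  have hdiff : derivMul L (k + 1) s κ - 4 * derivMul L k s κ = ∑ α ∈ s, c α := by
    simp only [derivMul, hc, mul_sum, ← sum_sub_distrib]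
    exact sum_congr rfl fun α _ => by ring
  rw [← sub_nonneg, hdiff]
  -- non-negativity of `c α` for `|α| ≥ 2`
  have hc_nonneg : ∀ α ∈ s, 2 ≤ ∑ i, α i → 0 ≤ c α := by
    intro α _ hα
    have hpow : 4 * L ^ (2 * k * (∑ i, α i - 1)) ≤ L ^ (2 * (k + 1) * (∑ i, α i - 1)) := by
      have h1 : L ^ (2 * (k + 1) * (∑ i, α i - 1)) =
          L ^ (2 * (∑ i, α i - 1)) * L ^ (2 * k * (∑ i, α i - 1)) := by
        rw [← pow_add]; congr 1; ring
      rw [h1]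
      refine mul_le_mul_of_nonneg_right ?_ (pow_nonneg hL0 _)
      calc (4 : ℝ) ≤ L ^ 2 := hL4
        _ ≤ L ^ (2 * (∑ i, α i - 1)) := pow_le_pow_right₀ hL1 (by omega)
    exact mul_nonneg (by linarith) (sq_nonneg _)
  -- the unit indices and the doubled unit indices
  set U₁ : Finset (Fin d → ℕ) := Finset.univ.image fun i : Fin d => (Pi.single i 1 : Fin d → ℕ)
  set U₂ : Finset (Fin d → ℕ) := Finset.univ.image fun i : Fin d => (Pi.single i 2 : Fin d → ℕ)
  have hinj1 : Set.InjOn (fun i : Fin d => (Pi.single i 1 : Fin d → ℕ)) ↑(Finset.univ : Finset (Fin d)) :=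
    fun i _ j _ h => by
      by_contra hij
      have := congrFun h i
      simp only [Pi.single_eq_same, Pi.single_apply, if_neg hij] at this
      exact one_ne_zero this
  have hinj2 : Set.InjOn (fun i : Fin d => (Pi.single i 2 : Fin d → ℕ)) ↑(Finset.univ : Finset (Fin d)) :=
    fun i _ j _ h => by
      by_contra hij
      have := congrFun h i
      simp only [Pi.single_eq_same, Pi.single_apply, if_neg hij] at this
      exact two_ne_zero this
  have hU₁s : U₁ ⊆ s := fun α hα => by
    obtain ⟨i, -, rfl⟩ := mem_image.1 hα; exact hs1 i
  have hU₂s : U₂ ⊆ s := fun α hα => by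
    obtain ⟨i, -, rfl⟩ := mem_image.1 hα; exact hs2 i
  have hdisj : Disjoint U₁ U₂ := by
    rw [Finset.disjoint_left]
    intro α h1 h2
    obtain ⟨i, -, rfl⟩ := mem_image.1 h1
    obtain ⟨j, -, hj⟩ := mem_image.1 h2
    have := congrFun hj j
    rw [Pi.single_eq_same, Pi.single_apply] at this
    split_ifs at this; omega
  have hUs : U₁ ∪ U₂ ⊆ s := union_subset hU₁s hU₂s
  -- split the sum: the rest has non-negative coefficients
  rw [← sum_sdiff hUs]
  have hrest : 0 ≤ ∑ α ∈ s \ (U₁ ∪ U₂), c α := by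
    refine sum_nonneg fun α hα => ?_
    rw [mem_sdiff, mem_union, not_or] at hα
    refine hc_nonneg α hα.1 ?_
    have h1 := hs α hα.1
    by_contra hlt
    have heq : ∑ i, α i = 1 := by omega
    obtain ⟨i, rfl⟩ := eq_single_of_sum_eq_one heq
    exact hα.2.1 (mem_image.2 ⟨i, mem_univ i, rfl⟩)
  -- the two explicit sums
  have hsum1 : ∑ α ∈ U₁, c α = ∑ i : Fin d, (-3) * ‖qmode κ i‖ ^ 2 := by
    rw [sum_image hinj1]
    refine sum_congr rfl fun i _ => ?_
    simp only [hc, Finset.sum_pi_single', mem_univ, if_true, Nat.sub_self, mul_zero, pow_zero,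
      norm_qpow_single]
    ring
  have hsum2 : ∑ α ∈ U₂, c α = ∑ i : Fin d, (L ^ 2 - 4) * L ^ (2 * k) * (‖qmode κ i‖ ^ 2) ^ 2 := by
    rw [sum_image hinj2]
    refine sum_congr rfl fun i _ => ?_
    simp only [hc, Finset.sum_pi_single', mem_univ, if_true, norm_qpow_single_two]
    have h1 : L ^ (2 * (k + 1) * (2 - 1)) = L ^ 2 * L ^ (2 * k) := by
      rw [← pow_add]; congr 1; ring
    have h2 : L ^ (2 * k * (2 - 1)) = L ^ (2 * k) := by norm_num
    rw [h1, h2]; ring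
  rw [sum_union hdisj, hsum1, hsum2, ← mul_sum, ← mul_sum]
  -- `3 |q|² ≤ (L²−4)L^{2k} Σ|q_i|⁴` from the hypothesis and Cauchy–Schwarz
  have hCS := qnormSq_sq_le κ
  have hq0 : 0 ≤ qnormSq κ := by unfold qnormSq; positivity
  have hcoef : 0 ≤ (L ^ 2 - 4) * L ^ (2 * k) := mul_nonneg (by linarith) (pow_nonneg hL0 _)
  have hS4 : 0 ≤ ∑ i : Fin d, (‖qmode κ i‖ ^ 2) ^ 2 := by positivity
  have hmain : 3 * qnormSq κ ≤ (L ^ 2 - 4) * L ^ (2 * k) * ∑ i : Fin d, (‖qmode κ i‖ ^ 2) ^ 2 := by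
    rcases Nat.eq_zero_or_pos d with hd | hd
    · subst hd
      simp [qnormSq]
    · have hdpos : (0 : ℝ) < d := by exact_mod_cast hd
      -- `3 d q ≤ (L²−4)L^{2k} q² ≤ (L²−4)L^{2k} d S₄`
      have h1 : 3 * (d : ℝ) * qnormSq κ ≤ (L ^ 2 - 4) * L ^ (2 * k) * qnormSq κ ^ 2 := by
        have := mul_le_mul_of_nonneg_right hκ hq0
        nlinarith
      have h2 : (L ^ 2 - 4) * L ^ (2 * k) * qnormSq κ ^ 2 ≤
          (L ^ 2 - 4) * L ^ (2 * k) * (d * ∑ i : Fin d, (‖qmode κ i‖ ^ 2) ^ 2) :=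
        mul_le_mul_of_nonneg_left hCS hcoef
      have h3 : (d : ℝ) * (3 * qnormSq κ) ≤
          (d : ℝ) * ((L ^ 2 - 4) * L ^ (2 * k) * ∑ i : Fin d, (‖qmode κ i‖ ^ 2) ^ 2) := by
        linarith
      exact le_of_mul_le_mul_left h3 hdpos
  have : qnormSq κ = ∑ i : Fin d, ‖qmode κ i‖ ^ 2 := rfl
  rw [this] at hmain
  linarith

/-- **(7.34)**: `4 m_k(p) ≤ m_{k+1}(p)` for `|p| ≥ L^{−k}`, provided `3dπ² ≤ 4(L² − 4)` (e.g. `L ≥ 8`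
for `d ≤ 8`) and `s ⊇ {e_i, 2e_i}` consists of indices of positive order.
[cite: AdamsBuchholzKoteckyMuller2019, Lemma 7.3 (7.34)] -/
theorem four_mul_derivMul_le_succ {L : ℝ} (hL : 2 ≤ L) (hLd : 3 * (d : ℝ) * π ^ 2 ≤ 4 * (L ^ 2 - 4))
    (k : ℕ) {s : Finset (Fin d → ℕ)} (hs : ∀ α ∈ s, 1 ≤ ∑ i, α i)
    (hs1 : ∀ i : Fin d, (Pi.single i 1 : Fin d → ℕ) ∈ s)
    (hs2 : ∀ i : Fin d, (Pi.single i 2 : Fin d → ℕ) ∈ s) {κ : Fin d → ZMod M}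
    (hκ : (L ^ k)⁻¹ ≤ momNorm κ) :
    4 * derivMul L k s κ ≤ derivMul L (k + 1) s κ := by
  refine derivMul_succ_sub_four_mul_nonneg hL k hs hs1 hs2 ?_
  -- `(L²−4) L^{2k} |q|² ≥ (L²−4) L^{2k} (4/π²)|p|² ≥ (L²−4)(4/π²) ≥ 3d`
  have hL0 : 0 < L := by linarith
  have hLk : 0 < L ^ k := pow_pos hL0 k
  have hq := (qnormSq_bounds κ).1
  have hp : 1 ≤ L ^ (2 * k) * momNorm κ ^ 2 := by
    have h1 : (L ^ k)⁻¹ * L ^ k = 1 := inv_mul_cancel₀ hLk.ne'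
    have h2 : 0 ≤ (L ^ k)⁻¹ := inv_nonneg.2 hLk.le
    have h3 : (L ^ k)⁻¹ * L ^ k ≤ momNorm κ * L ^ k := mul_le_mul_of_nonneg_right hκ hLk.le
    have h4 : 1 ≤ momNorm κ * L ^ k := by linarith
    have h5 : 1 ≤ (momNorm κ * L ^ k) ^ 2 := by nlinarith
    calc (1 : ℝ) ≤ (momNorm κ * L ^ k) ^ 2 := h5
      _ = L ^ (2 * k) * momNorm κ ^ 2 := by rw [mul_pow, ← pow_mul, mul_comm k 2]; ring
  have hcoef : 0 ≤ L ^ 2 - 4 := by nlinarith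
  have hπ : 0 < π ^ 2 := by positivity
  -- combine
  have h6 : (L ^ 2 - 4) * (4 / π ^ 2) ≤ (L ^ 2 - 4) * L ^ (2 * k) * qnormSq κ := by
    have : 4 / π ^ 2 ≤ L ^ (2 * k) * qnormSq κ := by
      calc 4 / π ^ 2 = 4 / π ^ 2 * 1 := by ring
        _ ≤ 4 / π ^ 2 * (L ^ (2 * k) * momNorm κ ^ 2) :=
            mul_le_mul_of_nonneg_left hp (by positivity)
        _ = L ^ (2 * k) * (4 / π ^ 2 * momNorm κ ^ 2) := by ring
        _ ≤ L ^ (2 * k) * qnormSq κ := mul_le_mul_of_nonneg_left hq (pow_nonneg hL0.le _)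
    have := mul_le_mul_of_nonneg_left this hcoef
    linarith [this]
  have h7 : 3 * (d : ℝ) ≤ (L ^ 2 - 4) * (4 / π ^ 2) := by
    rw [← mul_div_assoc, le_div_iff₀ hπ]
    linarith
  exact h7.trans h6

end Literature.MathematicalPhysics.StatisticalMechanics.GradientRG

end
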